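import Summits.NavierStokesRegularity.NavierStokesRegularity.Theorems.EfficiencyFloorNearSaturationNearMaximiserShape
import Summits.NavierStokesRegularity.NavierStokesRegularity.Theorems.EfficiencyFloorLerayFloorGapGlue
import Summits.NavierStokesRegularity.NavierStokesRegularity.Theorems.EfficiencyFloorSharpLuDoeringBudget
import Summits.NavierStokesRegularity.NavierStokesRegularity.Theorems.EfficiencyFloorCoveringUpgrade
import HarnessLib

/-!
# Route `EfficiencyFloor`, rung `LerayFloorGap` (stmt-NavierStokesRegularity-25164; rung one of `ProductionEfficiencyDecay`
# 22866): BY NAME, the rung follows from SHAPE STABILITY and the bet node `NearMaximiserBoundedAmplification`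

`--supports stmt-NavierStokesRegularity-25164 --as helper`. Pure composition of landed statements: the glue
`lerayFloorGapGlue_proof` (stmt-25485: `SharpLuDoeringBudget → NearSaturationNearMaximiser → NearMaximiserBoundedAmplification →
CoveringUpgrade → LerayFloorGap`), the closed parts `efficiencyFloor_sharpLuDoeringBudget_proof` (stmt-25481) and
`efficiencyFloor_coveringUpgrade_proof` (stmt-25484), and this generation's exact restatement
`nearSaturationNearMaximiser_iff_shape` (p819608: stmt-25482 ⟺ SHAPE, the quantitative stability of Lu–Doering near-maximisers
at pinned amplitude ratio).

* `lerayFloorGap_of_shape_of_nearMaximiserBoundedAmplification` — `SHAPE → NearMaximiserBoundedAmplification → LerayFloorGap`.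

READING. The open content of the rung `LerayFloorGap` is exactly {SHAPE (static, variational, XL), stmt-25483 (dynamical bet;
alternatively 25512 → 25513)}; by `…NearMaximiserBoundedAmplificationSubwindow` (p819888) the latter is confined to the last
`A⁻²`-sliver of the would-be blow-up window. HONEST FRAMING: an implication between OPEN statements; `LerayFloorGap`,
`ProductionEfficiencyDecay` (strictly above this rung) and Navier–Stokes regularity stay OPEN; no summit statement is proved.
[folklore]
-/

-- the problem directory repeats the summit name (`NavierStokesRegularity/NavierStokesRegularity`)
set_option linter.dupNamespace false

noncomputable section

namespace Summit.NavierStokesRegularity.NavierStokesRegularity.Theorems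

namespace NearSaturationNearMaximiser

open MeasureTheory
open scoped InnerProductSpace
open Literature.Analysis.FluidPDE

/-- **`LerayFloorGap` from SHAPE and the bet node, by name.** SHAPE (the right-hand side of
`nearSaturationNearMaximiser_iff_shape`) and `Theses.EfficiencyFloor.NearMaximiserBoundedAmplification` (stmt-25483) imply
`Theses.EfficiencyFloor.LerayFloorGap` (stmt-25164), through the landed glue and the two closed parts of the split. Implication
between OPEN statements; nothing is asserted unconditionally. [folklore] -/
theorem lerayFloorGap_of_shape_of_nearMaximiserBoundedAmplification
    (hshape : ∀ c ε : ℝ, (0 < c ∧ (∀ v : EuclideanSpace ℝ (Fin 3) → EuclideanSpace ℝ (Fin 3), (ContDiff ℝ (⊤ : ℕ∞) v ∧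
      Literature.Analysis.FluidPDE.VectorCalculus.IsDivFree v ∧ (∫⁻ x, ‖iteratedFDeriv ℝ 0 v x‖ₑ ^ 2 < ⊤) ∧
      (∫⁻ x, ‖iteratedFDeriv ℝ 1 v x‖ₑ ^ 2 < ⊤) ∧ (∫⁻ x, ‖iteratedFDeriv ℝ 2 v x‖ₑ ^ 2 < ⊤)) → (∫ x,
      ⟪Literature.Analysis.FluidPDE.curl v x, fderiv ℝ v x (Literature.Analysis.FluidPDE.curl v x)⟫_ℝ) ≤ c *
      (∫ x, ‖Literature.Analysis.FluidPDE.curl v x‖ ^ 2) ^ (3 / 4 : ℝ) * (∫ x,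
      Literature.Analysis.FluidPDE.frobeniusNormSq (fderiv ℝ (Literature.Analysis.FluidPDE.curl v) x)) ^ (3 /
      4 : ℝ)) ∧ ∀ c' : ℝ, (∀ w : EuclideanSpace ℝ (Fin 3) → EuclideanSpace ℝ (Fin 3), (ContDiff ℝ (⊤ : ℕ∞) w ∧
      Literature.Analysis.FluidPDE.VectorCalculus.IsDivFree w ∧ (∫⁻ x, ‖iteratedFDeriv ℝ 0 w x‖ₑ ^ 2 < ⊤) ∧
      (∫⁻ x, ‖iteratedFDeriv ℝ 1 w x‖ₑ ^ 2 < ⊤) ∧ (∫⁻ x, ‖iteratedFDeriv ℝ 2 w x‖ₑ ^ 2 < ⊤)) → (∫ x,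
      ⟪Literature.Analysis.FluidPDE.curl w x, fderiv ℝ w x (Literature.Analysis.FluidPDE.curl w x)⟫_ℝ) ≤ c' *
      (∫ x, ‖Literature.Analysis.FluidPDE.curl w x‖ ^ 2) ^ (3 / 4 : ℝ) * (∫ x,
      Literature.Analysis.FluidPDE.frobeniusNormSq (fderiv ℝ (Literature.Analysis.FluidPDE.curl w) x)) ^ (3 /
      4 : ℝ)) → c ≤ c') → 0 < ε → ∃ δ : ℝ, 0 < δ ∧ ∀ ν : ℝ, 0 < ν → ∀ v : EuclideanSpace ℝ (Fin 3) →
      EuclideanSpace ℝ (Fin 3), (ContDiff ℝ (⊤ : ℕ∞) v ∧ Literature.Analysis.FluidPDE.VectorCalculus.IsDivFree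
      v ∧ (∫⁻ x, ‖iteratedFDeriv ℝ 0 v x‖ₑ ^ 2 < ⊤) ∧ (∫⁻ x, ‖iteratedFDeriv ℝ 1 v x‖ₑ ^ 2 < ⊤) ∧ (∫⁻ x,
      ‖iteratedFDeriv ℝ 2 v x‖ₑ ^ 2 < ⊤)) → 0 < (∫ x, ‖Literature.Analysis.FluidPDE.curl v x‖ ^ 2) → (1 - δ) *
      (c * (∫ x, ‖Literature.Analysis.FluidPDE.curl v x‖ ^ 2) ^ (3 / 4 : ℝ) * (∫ x,
      Literature.Analysis.FluidPDE.frobeniusNormSq (fderiv ℝ (Literature.Analysis.FluidPDE.curl v) x)) ^ (3 /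
      4 : ℝ)) ≤ (∫ x, ⟪Literature.Analysis.FluidPDE.curl v x, fderiv ℝ v x (Literature.Analysis.FluidPDE.curl
      v x)⟫_ℝ) → |(∫ x, Literature.Analysis.FluidPDE.frobeniusNormSq (fderiv ℝ
      (Literature.Analysis.FluidPDE.curl v) x)) ^ (1 / 4 : ℝ) - 3 * c / (4 * ν) * (∫ x,
      ‖Literature.Analysis.FluidPDE.curl v x‖ ^ 2) ^ (3 / 4 : ℝ)| ≤ δ * (3 * c / (4 * ν) * (∫ x,
      ‖Literature.Analysis.FluidPDE.curl v x‖ ^ 2) ^ (3 / 4 : ℝ)) → ∃ m : EuclideanSpace ℝ (Fin 3) →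
      EuclideanSpace ℝ (Fin 3), ((ContDiff ℝ (⊤ : ℕ∞) m ∧
      Literature.Analysis.FluidPDE.VectorCalculus.IsDivFree m ∧ (∫⁻ x, ‖iteratedFDeriv ℝ 0 m x‖ₑ ^ 2 < ⊤) ∧
      (∫⁻ x, ‖iteratedFDeriv ℝ 1 m x‖ₑ ^ 2 < ⊤) ∧ (∫⁻ x, ‖iteratedFDeriv ℝ 2 m x‖ₑ ^ 2 < ⊤)) ∧ 0 < (∫ x,
      ‖Literature.Analysis.FluidPDE.curl m x‖ ^ 2) ∧ (∫ x, ⟪Literature.Analysis.FluidPDE.curl m x, fderiv ℝ m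
      x (Literature.Analysis.FluidPDE.curl m x)⟫_ℝ) = c * (∫ x, ‖Literature.Analysis.FluidPDE.curl m x‖ ^ 2) ^
      (3 / 4 : ℝ) * (∫ x, Literature.Analysis.FluidPDE.frobeniusNormSq (fderiv ℝ
      (Literature.Analysis.FluidPDE.curl m) x)) ^ (3 / 4 : ℝ) ∧ (∫ x,
      Literature.Analysis.FluidPDE.frobeniusNormSq (fderiv ℝ (Literature.Analysis.FluidPDE.curl m) x)) = 81 *
      c ^ 4 / (256 * ν ^ 4) * (∫ x, ‖Literature.Analysis.FluidPDE.curl m x‖ ^ 2) ^ 3) ∧ ((∫ x,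
      ‖Literature.Analysis.FluidPDE.curl (v - m) x‖ ^ 2) ≤ ε ^ 2 * (∫ x, ‖Literature.Analysis.FluidPDE.curl v
      x‖ ^ 2) ∧ (∫ x, Literature.Analysis.FluidPDE.frobeniusNormSq (fderiv ℝ
      (Literature.Analysis.FluidPDE.curl (v - m)) x)) ≤ ε ^ 2 * (∫ x,
      Literature.Analysis.FluidPDE.frobeniusNormSq (fderiv ℝ (Literature.Analysis.FluidPDE.curl v) x))))
    (hbet : Summit.NavierStokesRegularity.NavierStokesRegularity.Theses.EfficiencyFloor.NearMaximiserBoundedAmplification) :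
    Summit.NavierStokesRegularity.NavierStokesRegularity.Theses.EfficiencyFloor.LerayFloorGap :=
  lerayFloorGapGlue_proof efficiencyFloor_sharpLuDoeringBudget_proof
    (nearSaturationNearMaximiser_iff_shape.2 hshape) hbet
    EfficiencyFloorCoveringUpgrade.efficiencyFloor_coveringUpgrade_proof

end NearSaturationNearMaximiser

end Summit.NavierStokesRegularity.NavierStokesRegularity.Theorems

end
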